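import Summits.CriticalPhenomena.PercolationContinuityZ3.Theorems.Transplant.SkelNegBParamsCorrOK
import Summits.CriticalPhenomena.PercolationContinuityZ3.Theorems.Transplant.SkelNegBParamsCorrA
import HarnessLib

/-!
# N1 params, chain of record `NegB`, part CorrOK-A — the (ζ′) twin of part CorrOK (p28xxxx) at `A := Aof κ = 20·K` ((C) column): THE TWO ESTIMATE FIELDS OF `LocOK`
# FOR THE (ζ′) PHASE-1 RECORD `locPrm₁A` — `0 ≤ sLo` and `e ≤ sLo` ("kit depth + reading slack < cells per v-stride"), hence **`NegB.locOK₁A : ChainPara.LocOK (locPrm₁A …)`**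
# and `e < sLo` (for `hNA_at`), from the numeric long clause, the shear bound `|h_L| ≤ 10·n_L` of the chosen orientation, and the floors (`4K(R′+2) ≤ M_L < ℓ_L`, `K ≥ 40`)
# (stmt-g16 2026-08-22; NEG-SCOPE §B.19 (ζ′): the reading slack `z ≤ 12` and the along floor `X ≤ aLo ⇐ 33X + 11 ≤ ℓ_L` are A-FREE — `A` cancels between `c_i = A·s_i` and
# `D_A = A²·modulus`; the cell-free `U_le/U_eq/md_layer/abs_num_core/abs_num_four/ℓL_ge` are part CorrOK's, reused)
THE TWO ESTIMATES, at `A`: (i) **`z ≤ 12`**: `|numerator| ≤ 11·n·|v_α|`, inner floor within `±11·A·|v_α|`, and `c₀·A·|v_α| ≤ D_A` (`cL_le_D_fcellsA_at`), so `|TrdA| ≤ 11`;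
(ii) **`X ≤ aLo` whenever `33·X + 11 ≤ ℓ_L`**: `D_A < 20K·A·(n+|h|)·(m₁+1)`, `m₁ + 1 ≤ 3(m₁ − 1)`, so `X·D_A ≤ 20K·s₁·A·β_lo = c₁·A·β_lo` as soon as `3·X·(n+|h|) ≤ β_lo`.
So the phase-1 corridor keeps today's admissibility (`z ≤ 12`, `e ≤ R′ + 12`, `R′ + 13 ≤ sLo`); what the (ζ′) cells change is the TRUE size `sLo ≈ s₁ ≈ Kq`× today's and the
rounds `N ≈ 3r₁/s₁ = 3K` (the (C) column's `nmaxC`, its files).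
builds on p205010 (kernel theorem, internal audit signed; external expert review pending) — nothing in this file uses p205010; NOTHING is claimed about the node
`SamePDropOfSkeletonNeg₁` (OPEN).
Lane `prim-bschramm-*`, seat `prim-bschramm-stmt` (gen 16); helper file (`--supports stmt-CriticalPhenomena-4575 --as helper`); ledger HOME/prim-bschramm-stmt/NEG-PARAMS.md.
* §1 `abs_TrdA_le`, **`zCA_le`** (`z ≤ 12`); §2 `DdA_lt` (`D_A < 20K·A·L̂₁·(s₁+2)`), **`le_aLoA`**; §3 **`locOKA_hs0_at`**, **`eA_lt_sLo_at`**, **`locOKA_he_at`**, **`locOK₁A`**, `hN₁A`,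
  `slack_factsA`.
[cite: KozmaNitzan2024, §4 Lemma 12 (pp. 23–25)] [cite: MartineauTassion2017, §4.3 Lemma 4.2]
-/

noncomputable section

open scoped Classical

namespace Summit.CriticalPhenomena.PercolationContinuityZ3.Theorems.Transplant

namespace PlanarSkeletonNeg

namespace NegB

open Literature.Probability.Percolation Literature.Probability.LatticeModels SimpleGraph
open SkelConc (Consts)
open Neg
open TwoAxis.Para (modulus)

section CorrOK

variable (κ : Consts) {V : Type} [DecidableEq V] [Countable V] {G : SimpleGraph V} [G.LocallyFinite] (Φ : PlanarSkeletonNeg G) (t : V)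
  (p : unitInterval) (D : Skelφ.StepI.DataN V) (g f : ℕ)

/-! ## §1 The reading slack is at most `12` -/

/-- **`|TrdA x B| ≤ 11`** whenever `|m·x − B| ≤ 11·n·|v_α|` (inner floor within `±11·A·|v_α|`, then `c₀·11·A·|v_α| ≤ 11·D_A`). [this work] -/
theorem abs_TrdA_le (hN : EqNumL κ Φ t p D g f) {x B : ℤ} (hB : |md κ Φ t p D g f * x - B| ≤ 11 * (nL κ Φ t p D g f : ℤ) * |vL κ Φ t p D g f|) :
    |TrdA κ Φ t p D g f x B| ≤ 11 := by
  have hn1 : (1 : ℤ) ≤ nL κ Φ t p D g f := by exact_mod_cast (one_le_of_eqNumL κ Φ t p D g f hN).1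
  have hn0 : (0 : ℤ) < nL κ Φ t p D g f := by linarith
  have hD := DdA_pos κ Φ t p D g f hN
  have hA : 0 < Aof κ := (Aof_pos κ).1
  have hc0 : 0 ≤ c0A κ Φ t p D g f := (cA_nonneg' κ Φ t p D g f).1
  -- inner floor
  set q : ℤ := Aof κ * (md κ Φ t p D g f * x - B) / (nL κ Φ t p D g f : ℤ) with hq
  have hB' := abs_le.1 hB
  have hq1 : q ≤ 11 * Aof κ * |vL κ Φ t p D g f| := by
    rw [hq]; refine Int.ediv_le_of_le_mul hn0 ?_
    have := mul_le_mul_of_nonneg_left hB'.2 hA.le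
    linarith
  have hq2 : -(11 * Aof κ * |vL κ Φ t p D g f|) ≤ q := by
    rw [hq]; refine Int.le_ediv_of_mul_le hn0 ?_
    have := mul_le_mul_of_nonneg_left hB'.1 hA.le
    linarith
  -- the resolution inequality `c₀·A·(|vβ|+|vα|) ≤ D_A`
  have hres := (cL_le_D_fcellsA_at κ Φ t p D g f hN).1
  rw [(fcellsA_K κ Φ t p D g f).1] at hres
  have eA : |Aof κ| = Aof κ := abs_of_pos hA
  rw [eA] at hres
  have hc0' : c0A κ Φ t p D g f = 20 * (Neg.K κ : ℤ) * (((fcellsA κ Φ t p D g f).s 0 : ℕ) : ℤ) := by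
    unfold c0A; rw [(fcellsA_K κ Φ t p D g f).1]
  have hres' : c0A κ Φ t p D g f * (Aof κ * |vL κ Φ t p D g f|) ≤ DdA κ Φ t p D g f := by
    rw [hc0']
    have : 20 * (Neg.K κ : ℤ) * (((fcellsA κ Φ t p D g f).s 0 : ℕ) : ℤ) * (Aof κ * |vL κ Φ t p D g f|) ≤
        20 * (Neg.K κ : ℤ) * (((fcellsA κ Φ t p D g f).s 0 : ℕ) : ℤ) * (Aof κ * (|vβL κ Φ t p D g f| + |vL κ Φ t p D g f|)) := by
      have hK : (0 : ℤ) ≤ 20 * (Neg.K κ : ℤ) * (((fcellsA κ Φ t p D g f).s 0 : ℕ) : ℤ) :=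
        mul_nonneg (mul_nonneg (by norm_num) (Nat.cast_nonneg _)) (Nat.cast_nonneg _)
      exact mul_le_mul_of_nonneg_left (mul_le_mul_of_nonneg_left (by linarith [abs_nonneg (vβL κ Φ t p D g f)]) hA.le) hK
    exact this.trans hres
  -- outer floor
  unfold TrdA
  rw [← hq, abs_le]
  have l1 := mul_le_mul_of_nonneg_left hq2 hc0
  have l2 := mul_le_mul_of_nonneg_left hq1 hc0
  constructor
  · refine Int.le_ediv_of_mul_le hD ?_
    linarith
  · refine Int.ediv_le_of_le_mul hD ?_
    linarith

/-- **THE READING SLACK IS AT MOST `12`**. [this work] -/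
theorem zCA_le (hN : EqNumL κ Φ t p D g f) (hκ : (hL κ Φ t p D g f).natAbs ≤ 10 * nL κ Φ t p D g f) : zCA κ Φ t p D g f ≤ 12 := by
  obtain ⟨b1, b2, b3, b4⟩ := abs_num_four κ Φ t p D g f hN hκ
  have t1 := abs_le.1 (abs_TrdA_le κ Φ t p D g f hN b1)
  have t2 := abs_le.1 (abs_TrdA_le κ Φ t p D g f hN b2)
  have t3 := abs_le.1 (abs_TrdA_le κ Φ t p D g f hN b3)
  have t4 := abs_le.1 (abs_TrdA_le κ Φ t p D g f hN b4)
  unfold zCA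
  have : (max (max (TrdA κ Φ t p D g f (vL κ Φ t p D g f) (Bmin κ Φ t p D g f) + 1) (TrdA κ Φ t p D g f (-vL κ Φ t p D g f) (Bmin' κ Φ t p D g f) + 1))
      (max (-TrdA κ Φ t p D g f (vL κ Φ t p D g f) (Bmax κ Φ t p D g f)) (-TrdA κ Φ t p D g f (-vL κ Φ t p D g f) (Bmax' κ Φ t p D g f)))) ≤ 12 := by
    refine max_le (max_le ?_ ?_) (max_le ?_ ?_) <;> linarith [t1.2, t2.1, t3.2, t4.1]
  omega

/-! ## §2 The along floor: cells per v-stride -/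

/-- **`D_A < 20K·(A·(n+|h|))·(s₁ + 2)`** from the definition of `m^A₁` (`s₁ = m^A₁ − 1`). [folklore] -/
theorem DdA_lt (hN : EqNumL κ Φ t p D g f) :
    DdA κ Φ t p D g f < 20 * (Neg.K κ : ℤ) * (Aof κ * ((nL κ Φ t p D g f : ℤ) + |hL κ Φ t p D g f|)) * ((((fcellsA κ Φ t p D g f).s 1 : ℕ) : ℤ) + 2) := by
  have hn1 : (1 : ℤ) ≤ nL κ Φ t p D g f := by exact_mod_cast (one_le_of_eqNumL κ Φ t p D g f hN).1
  have hK : (1 : ℤ) ≤ Neg.K κ := by exact_mod_cast (Neg.forty_le_K κ).2.2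
  have hA : 0 < Aof κ := (Aof_pos κ).1
  have hL1 : (0 : ℤ) < Skelφ.NegPrm.L1hat (nL κ Φ t p D g f) (hL κ Φ t p D g f) := by
    unfold Skelφ.NegPrm.L1hat; linarith [abs_nonneg (hL κ Φ t p D g f)]
  have hb : (0 : ℤ) < 20 * (Neg.K κ : ℤ) * (Aof κ * Skelφ.NegPrm.L1hat (nL κ Φ t p D g f) (hL κ Φ t p D g f)) :=
    mul_pos (mul_pos (by norm_num) (by linarith)) (mul_pos hA hL1)
  have key := Int.lt_ediv_add_one_mul_self (DdA κ Φ t p D g f) hb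
  have hs1 : (((fcellsA κ Φ t p D g f).s 1 : ℕ) : ℤ) + 2 = m1A κ Φ t p D g f + 1 := by
    rw [(fcellsA_s_at κ Φ t p D g f hN).2]; unfold fm1A; ring
  have hm1 : m1A κ Φ t p D g f = DdA κ Φ t p D g f / (20 * (Neg.K κ : ℤ) * (Aof κ * Skelφ.NegPrm.L1hat (nL κ Φ t p D g f) (hL κ Φ t p D g f))) := rfl
  rw [hs1, hm1]
  have eL : ((nL κ Φ t p D g f : ℤ) + |hL κ Φ t p D g f|) = Skelφ.NegPrm.L1hat (nL κ Φ t p D g f) (hL κ Φ t p D g f) := rfl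
  rw [eL]
  linarith [key]

/-- **`X ≤ aLoA` whenever `0 ≤ X` and `33·X + 11 ≤ ℓ_L`** (and the shear bound) — the same threshold as today (`A` cancels). [this work] -/
theorem le_aLoA (hN : EqNumL κ Φ t p D g f) (hκ : (hL κ Φ t p D g f).natAbs ≤ 10 * nL κ Φ t p D g f) {X : ℤ} (hX : 0 ≤ X)
    (hℓ : 33 * X + 11 ≤ (ℓL κ Φ t p D g f : ℤ)) : X ≤ aLoA κ Φ t p D g f := by
  have hn1 : (1 : ℤ) ≤ nL κ Φ t p D g f := by exact_mod_cast (one_le_of_eqNumL κ Φ t p D g f hN).1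
  have hD := DdA_pos κ Φ t p D g f hN
  have hK : (1 : ℤ) ≤ Neg.K κ := by exact_mod_cast (Neg.forty_le_K κ).2.2
  have hA : 0 < Aof κ := (Aof_pos κ).1
  have hs1 : (1 : ℤ) ≤ (((fcellsA κ Φ t p D g f).s 1 : ℕ) : ℤ) := by exact_mod_cast (fcellsA κ Φ t p D g f).hs 1
  have hU := U_le κ Φ t p D g f hκ
  have hUe := U_eq κ Φ t p D g f
  have hlt := DdA_lt κ Φ t p D g f hN
  set s1 : ℤ := (((fcellsA κ Φ t p D g f).s 1 : ℕ) : ℤ) with hs1d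
  set U : ℤ := (nL κ Φ t p D g f : ℤ) + |hL κ Φ t p D g f| with hUd
  have hU' : U ≤ 11 * (nL κ Φ t p D g f : ℤ) := by rw [← hUe]; exact hU
  have hU0 : 1 ≤ U := by rw [hUd]; linarith [abs_nonneg (hL κ Φ t p D g f)]
  have hβ : βlo κ Φ t p D g f = (nL κ Φ t p D g f : ℤ) * ℓL κ Φ t p D g f - U + 1 := by unfold βlo; rw [hUe]
  have hc1 : c1A κ Φ t p D g f = 20 * (Neg.K κ : ℤ) * s1 := by unfold c1A; rw [(fcellsA_K κ Φ t p D g f).1]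
  unfold aLoA
  refine Int.le_ediv_of_mul_le hD ?_
  rw [hc1, hβ]
  have step1 : X * DdA κ Φ t p D g f ≤ X * (20 * (Neg.K κ : ℤ) * (Aof κ * U) * (s1 + 2)) := mul_le_mul_of_nonneg_left hlt.le hX
  have step2 : X * U * (s1 + 2) ≤ s1 * ((nL κ Φ t p D g f : ℤ) * ℓL κ Φ t p D g f - U + 1) := by
    have a1 : X * U * (s1 + 2) ≤ 3 * X * U * s1 := by nlinarith [mul_nonneg hX (by linarith : (0 : ℤ) ≤ U)]
    have a2 : 3 * X * U ≤ 33 * X * (nL κ Φ t p D g f : ℤ) := by nlinarith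
    have a3 : 33 * X * (nL κ Φ t p D g f : ℤ) ≤ (nL κ Φ t p D g f : ℤ) * ℓL κ Φ t p D g f - U + 1 := by nlinarith
    nlinarith
  have hK0 : (0 : ℤ) ≤ 20 * (Neg.K κ : ℤ) * Aof κ := mul_nonneg (by linarith) hA.le
  calc X * DdA κ Φ t p D g f ≤ X * (20 * (Neg.K κ : ℤ) * (Aof κ * U) * (s1 + 2)) := step1
    _ = 20 * (Neg.K κ : ℤ) * Aof κ * (X * U * (s1 + 2)) := by ring
    _ ≤ 20 * (Neg.K κ : ℤ) * Aof κ * (s1 * ((nL κ Φ t p D g f : ℤ) * ℓL κ Φ t p D g f - U + 1)) := mul_le_mul_of_nonneg_left step2 hK0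
    _ = 20 * (Neg.K κ : ℤ) * s1 * (Aof κ * ((nL κ Φ t p D g f : ℤ) * ℓL κ Φ t p D g f - U + 1)) := by ring

/-! ## §3 `LocOK` -/

/-- **`LocOK.hs0`**: `0 ≤ sLo` (`1 ≤ aLoA`, i.e. `ℓ_L ≥ 44`). [this work] -/
theorem locOKA_hs0_at (hN : EqNumL κ Φ t p D g f) (hκ : (hL κ Φ t p D g f).natAbs ≤ 10 * nL κ Φ t p D g f) : 0 ≤ (locPrm₁A κ Φ t p D g f).sLo := by
  show 0 ≤ sLoCA κ Φ t p D g f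
  have hR : (3 : ℤ) ≤ R' κ Φ t p D := by exact_mod_cast three_le_R' κ Φ t p D
  have hℓ := ℓL_ge κ Φ t p D g f hN
  have h := le_aLoA κ Φ t p D g f hN hκ (X := 1) (by norm_num) (by linarith)
  unfold sLoCA; linarith

/-- **`e < sLo`**: kit depth + reading slack is STRICTLY below the minimal v-stride progress (`e ≤ R′ + 12`, `sLo ≥ R′ + 13`). [this work] -/
theorem eA_lt_sLo_at (hN : EqNumL κ Φ t p D g f) (hκ : (hL κ Φ t p D g f).natAbs ≤ 10 * nL κ Φ t p D g f) :
    ((locPrm₁A κ Φ t p D g f).e : ℤ) < (locPrm₁A κ Φ t p D g f).sLo := by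
  show ((eCA κ Φ t p D g f : ℕ) : ℤ) < sLoCA κ Φ t p D g f
  have hz := zCA_le κ Φ t p D g f hN hκ
  have hR := three_le_R' κ Φ t p D
  have hℓ := ℓL_ge κ Φ t p D g f hN
  have hR' : (3 : ℤ) ≤ R' κ Φ t p D := by exact_mod_cast hR
  have h := le_aLoA κ Φ t p D g f hN hκ (X := (R' κ Φ t p D : ℤ) + 14) (by positivity) (by linarith)
  have he : ((eCA κ Φ t p D g f : ℕ) : ℤ) ≤ (R' κ Φ t p D : ℤ) + 12 := by
    unfold eCA; push_cast
    have : (zCA κ Φ t p D g f : ℤ) ≤ 12 := by exact_mod_cast hz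
    linarith
  unfold sLoCA; linarith

/-- **`LocOK.he`**: `e ≤ sLo`. [this work] -/
theorem locOKA_he_at (hN : EqNumL κ Φ t p D g f) (hκ : (hL κ Φ t p D g f).natAbs ≤ 10 * nL κ Φ t p D g f) :
    ((locPrm₁A κ Φ t p D g f).e : ℤ) ≤ (locPrm₁A κ Φ t p D g f).sLo := (eA_lt_sLo_at κ Φ t p D g f hN hκ).le

/-- **THE PHASE-1 RECORD OF RECORD IS ADMISSIBLE**: `LocOK (locPrm₁A κ Φ t p D g f)` under the numeric long clause and the shear bound of the chosen orientation.
[cite: KozmaNitzan2024, §4 Lemma 12 (pp. 23–25)] -/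
theorem locOK₁A (hN : EqNumL κ Φ t p D g f) (hκ : (hL κ Φ t p D g f).natAbs ≤ 10 * nL κ Φ t p D g f) : ChainPara.LocOK (locPrm₁A κ Φ t p D g f) :=
  locOKA_of κ Φ t p D g f hN (locOKA_hs0_at κ Φ t p D g f hN hκ) (locOKA_he_at κ Φ t p D g f hN hκ)

/-- **The rounds inequality**: `L0 ≤ sHi + (N+1)·(sLo − e)`. [folklore] -/
theorem hN₁A (hN : EqNumL κ Φ t p D g f) (hκ : (hL κ Φ t p D g f).natAbs ≤ 10 * nL κ Φ t p D g f) :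
    ((locPrm₁A κ Φ t p D g f).L0 : ℤ) ≤ (locPrm₁A κ Φ t p D g f).sHi + (((locPrm₁A κ Φ t p D g f).N : ℕ) + 1 : ℤ) * ((locPrm₁A κ Φ t p D g f).sLo - (locPrm₁A κ Φ t p D g f).e) :=
  hNA_at κ Φ t p D g f (eA_lt_sLo_at κ Φ t p D g f hN hκ)

/-- The slack and the kit radius, numerically: `z ≤ 12`, `e ≤ R′ + 12`, `R′ + 13 ≤ sLo`. [folklore] -/
theorem slack_factsA (hN : EqNumL κ Φ t p D g f) (hκ : (hL κ Φ t p D g f).natAbs ≤ 10 * nL κ Φ t p D g f) :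
    zCA κ Φ t p D g f ≤ 12 ∧ (locPrm₁A κ Φ t p D g f).e ≤ R' κ Φ t p D + 12 ∧ (R' κ Φ t p D : ℤ) + 13 ≤ (locPrm₁A κ Φ t p D g f).sLo := by
  have hz := zCA_le κ Φ t p D g f hN hκ
  have hR' : (3 : ℤ) ≤ R' κ Φ t p D := by exact_mod_cast three_le_R' κ Φ t p D
  have h := le_aLoA κ Φ t p D g f hN hκ (X := (R' κ Φ t p D : ℤ) + 14) (by positivity) (by linarith [ℓL_ge κ Φ t p D g f hN])
  refine ⟨hz, ?_, ?_⟩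
  · show eCA κ Φ t p D g f ≤ _
    unfold eCA; omega
  · show _ ≤ sLoCA κ Φ t p D g f
    unfold sLoCA; linarith

end CorrOK

end NegB

end PlanarSkeletonNeg

end Summit.CriticalPhenomena.PercolationContinuityZ3.Theorems.Transplant

end
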